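import Summits.CriticalPhenomena.Ising3DConformalLimit.Theses.PerfectScreening
import Summits.CriticalPhenomena.Ising3DConformalLimit.Theses.PrecisionLaplacian
import Summits.CriticalPhenomena.Ising3DConformalLimit.Theorems.PrecisionLaplacianInverseMCriticalKernel
import Literature.Probability.LatticeModels.PointwiseScalingLimitEtaExists
import Literature.Probability.LatticeModels.CriticalTwoPointLower
import Literature.Probability.LatticeModels.HighDimPointwiseTriviality
import Literature.Probability.LatticeModels.LatticeLaplacianZd

/-!
# Line `direct-correlation-shells` — skeleton for crux `SubharmonicOffOrigin` (stmt-CriticalPhenomena-1341)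

Crux (route `PerfectScreening`, rank 2, "SubH"): `∀ x ≠ 0, 6·G(x) ≤ Σᵢ (G(x+eᵢ) + G(x−eᵢ))`,
`G = criticalTwoPoint 3 = ⟨σ₀σ_x⟩⁺_{β_c(3)}`.

## The line (idea card `Ideas/direct-correlation-shells.md`, merged with `inverse-m-long-jump` per triage r1)

LEVER: the Ornstein–Zernike DIRECT-CORRELATION FUNCTION of the critical state — the canonical precision
kernel `a(y) = dcf y := inf_{A ∋ 0,y} −(G_A⁻¹)(0,y)` of route `PrecisionLaplacian` (items 4798 → 4802 → 4803).
Item 4803 (`PrecisionIsLaplacian`) says: `a` is summable, `a ≥ 0` off `0`, total mass `0` (criticality,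
`χ = ∞`) and `G` is `a`-harmonic off the origin, `Σ_y a(y)·[G(x) − G(x−y)] = 0` for `x ≠ 0`
(`hasSum_balance` below). Splitting off the six unit steps, on which `a ≡ a₁` (proved: `dcf_single`, `dcf_neg`) with
`a₁ > 0` (stub `UnitRate`):
`a₁ · [N(x) − 6G(x)] = Σ_{y ∉ {0,±eᵢ}} a(y)·[G(x) − G(x−y)]`. At a UNIT STEP `x = ±eᵢ` every term on the
right is `≥ 0`, because `x − y ≠ 0` and `G(z) ≤ G(e₀) = max_{z≠0} G` (Messager–Miracle-Solé sandwich +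
axis antitonicity, tree). Hence THE RAZOR-THIN SITES OF SubH (`|x| = 1`, margin ≈ 1–3 %: refuter notes
80a57a10 / bc059723 / rattack on the item) ARE A THEOREM MODULO IM — proved here, kernel-checked:
`firstShell`. Contrapositive (cross-route kill, proved): a Monte-Carlo `N(e₁) < 6G(e₁)` refutes
`InverseMFerromagnet` for critical `ℤ³` Ising (`not_inverseM_of_unitStep_violation`).

Beyond the first shell the lever is sign-neutral (triage r1-1/2/3: under IM the long-range form is SubH
rewritten; kit j013068: the NNN-Gaussian `G_a` has IM, passes shell 1 and fails SubH at `(1,1,0)`), so the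
remaining sites are cut along the pool's coverage map into two PARTNER stubs with ONE explicit radius
`R₀ = 2` (sup norm, the same cut as line `certified-core-eventual-tail`): `NearField` (the 8 non-unit
site classes with `|x|∞ ≤ 2` — the habitat of the β-bracket LP/SDP certificate cards `certified-core-eventual-tail ≈ sdp-bracket-certificate`, with their
thinnest-relative row `|x| = 1` REMOVED by `firstShell`) and `FarField` (`|x|∞ > 2`, EFFECTIVE — the hard
core; candidate suppliers: `kl-band-positivity`'s shape condition, the route's RP-spectral cone + diagonal
transfer matrix, or an effective tail transfer from `DirectCorrelationStableTail` (4799); the route's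
pre-filed `EventuallySubharmonic` (13887) is the INEFFECTIVE `∃R` version and does not suffice).

## Registered stubs (3 new) + delegated obligations (2 route items, by name)

* `stub_unitRate`  (M, new): `InverseMFerromagnet → 0 < a(e₀)` — POSITIVITY of the nearest-neighbour direct
  correlation (not delivered by 4803: the √2/√3 steps alone generate `ℤ³`; plausible: `a₁ = t + O(t³)` in
  the HT expansion, `a₁/A₀ ≈ 0.15` at `β_c`; a proof = partial covariance of `σ₀, σ_{e₁}` given the rest
  bounded below, or IM-monotone Schur complements bounded below by a DLR/finite-energy argument). The
  cubic SYMMETRY of the canonical kernel on the unit steps (`a(±eᵢ) = a(e₀)`), which 4803 also omits, is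
  PROVED here unconditionally (`dcf_equivariant`: transport of `inf_A −(G_A⁻¹)(0,·)` under any additive
  lattice symmetry fixing `G`, via `Matrix.inv_reindex`; instances `dcf_single`, `dcf_neg`).
* `stub_nearField` (L, partner): SubH at the 8 site classes `x ∉ {0, ±eᵢ}`, `|x|∞ ≤ 2` — a FINITE
  statement (β-uniform dual certificate on a rigorous bracket of `β_c(3)`; IdeatorK3Sketch
  `NearFieldOnBracket`, `nearField_critical_of_bracket`).
* `stub_farField`  (open-problem, partner, HARDEST): SubH for `|x|∞ > 2`, effective radius.
* by name (tagged route items, not re-registered): `PrecisionLaplacian.InverseMFerromagnet` (stmt-4798,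
  crux r2 of route PrecisionLaplacian, [open-problem]) and `PrecisionLaplacian.PrecisionIsLaplacian`
  (stmt-4803, support, M; partial Theorems files `…PrecisionIsLaplacianRows/InvMonotone/Convolution`);
  `InverseMCriticalKernel` (stmt-4802) is LANDED and used as `Theorems.InverseMCriticalKernel_proof`.

Composition `SubharmonicOffOrigin_of` (no `sorry`): case split `x ∈ {±eᵢ}` (→ `firstShell`) /
`|x|∞ ≤ 2` (→ NearField) / `|x|∞ > 2` (→ FarField); concludes
`Summit.CriticalPhenomena.Ising3DConformalLimit.Theses.PerfectScreening.SubharmonicOffOrigin` BY NAME.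

## Disproof.lean used (cdisprove cycle 1)
* `subharmonicOffOrigin_false_without_neZero` — honoured: `x ≠ 0` is used exactly at the source term
  (`hasSum_balance` needs `x ≠ 0` for `Σ_y a(y)G(x−y) = 0`; at `x = 0` it is `−1`), and `firstShell` needs
  `x − y ≠ 0`; `stub_farField`'s hypothesis implies `x ≠ 0`, `stub_nearField` carries it.
* `not_uniformlyStrictSubharmonic` / `eventually_nbrSum_axis_lt` / `tendsto_nbrSum_div_of_subharmonicOffOrigin`
  — honoured: no stub claims a uniform slack; `firstShell` is identity-level (exact balance `HasSum … 0`).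
* `le_axis_of_coords` (= `criticalTwoPoint_axis_sandwich`) — USED, as `G_le_G_e0`.
* `-- Targets`: none yet. No landed `Negative/` lemma exists for this crux (nothing to import/check against).

## Triage answers (r1-1 (iv), r1-2 (iv)/(v), r1-3 sharpen)
LRSuper/LJS dropped as a transfer target; `a₁ > 0` is the explicit stub `UnitRate` (its symmetry half is
proved here); the kernel form is taken from item 4803 BY NAME (ideator 3's `PrecisionData` shape) with
ideator 2's proof of L1, and L0 is proved (`longJump_identity`); the first shell is a COMPONENT and the two
partners are named with one shared explicit radius `R₀ = 2` = certified-core's `coreRadius`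
(effectivity caveat of r1-3; interoperability `farField_iff_normForm`).
-/

noncomputable section

open Filter Topology
open Literature.Probability.LatticeModels

namespace Summit.CriticalPhenomena.Ising3DConformalLimit.Cruxes.SubharmonicOffOrigin.DirectCorrelationShells

/-! ## Objects -/

/-- `G = ⟨σ₀σ_x⟩⁺_{β_c(3)}` on `ℤ³` (notation, purely syntactic). -/
local notation "G" => Literature.Probability.LatticeModels.criticalTwoPoint 3

/-- The neighbour sum `N(x) = Σᵢ (G(x+eᵢ) + G(x−eᵢ))`; the crux is `6·G(x) ≤ N(x)` for `x ≠ 0`. -/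
def nbrSum (x : Site 3) : ℝ := ∑ i : Fin 3, (G (x + Pi.single i 1) + G (x - Pi.single i 1))

/-- The CANONICAL DIRECT-CORRELATION FUNCTION (precision kernel) of the critical state, verbatim the
function of item 4803 `PrecisionIsLaplacian`: `dcf y = inf_{A ∋ 0, y} −(G_A⁻¹)(0, y)` over finite
`A ⊂ ℤ³` (`= a(y) ≥ 0` for `y ≠ 0` and `= −A₀ < 0` at `y = 0`, under IM). -/
def dcf (y : Site 3) : ℝ :=
  ⨅ A : {A : Finset (Site 3) // (0 : Site 3) ∈ A ∧ y ∈ A},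
    -((Matrix.of fun (p q : ↥A.1) => criticalTwoPoint 3 (q.1 - p.1))⁻¹ ⟨0, A.2.1⟩ ⟨y, A.2.2⟩)

/-- The symmetric-potential property of the critical kernel (conclusion of item 4802
`InverseMCriticalKernel`, hypothesis of 4803 / 4799), verbatim. -/
def IsSymmetricPotential : Prop :=
  ∀ A : Finset (Site 3), (Matrix.of fun (p q : ↥A) => criticalTwoPoint 3 (q.1 - p.1)).PosDef ∧
    ∀ u v : ↥A, (u ≠ v → (Matrix.of fun (p q : ↥A) => criticalTwoPoint 3 (q.1 - p.1))⁻¹ u v ≤ 0) ∧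
      0 ≤ ∑ w, (Matrix.of fun (p q : ↥A) => criticalTwoPoint 3 (q.1 - p.1))⁻¹ u w

/-- The KERNEL FORM delivered by item 4803 `PrecisionIsLaplacian`, written with `dcf`: summable, total
mass `0`, nonnegative off `0`, negative at `0`, and minus the convolution inverse of `G`. -/
def KernelForm : Prop :=
  Summable dcf ∧ (∑' y, dcf y) = 0 ∧ (∀ y : Site 3, y ≠ 0 → 0 ≤ dcf y) ∧ dcf 0 < 0 ∧
    ∀ z : Site 3, (∑' y, dcf y * G (z - y)) = if z = 0 then -1 else 0

/-- Transcription check: item 4802 is literally `IM → IsSymmetricPotential`. -/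
theorem inverseMCriticalKernel_iff :
    Summit.CriticalPhenomena.Ising3DConformalLimit.Theses.PrecisionLaplacian.InverseMCriticalKernel ↔
      (Summit.CriticalPhenomena.Ising3DConformalLimit.Theses.PrecisionLaplacian.InverseMFerromagnet →
        IsSymmetricPotential) :=
  Iff.rfl

/-- Transcription check: item 4803 is literally `IsSymmetricPotential → KernelForm`. -/
theorem precisionIsLaplacian_iff :
    Summit.CriticalPhenomena.Ising3DConformalLimit.Theses.PrecisionLaplacian.PrecisionIsLaplacian ↔
      (IsSymmetricPotential → KernelForm) :=
  Iff.rfl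

/-! ## The three NEW statements of the line (named `Prop`s; the registered `stub_*` theorems restate them
verbatim and fully qualified; `Registered.stub_*` are the name-keyed aliases taken as hypotheses of
`SubharmonicOffOrigin_of` — the skeleton audit admits a hypothesis whose head's last name component is a
declared stub, same device as `ABC/Cruxes/MazurKaneLaw/Lines/*.lean`) -/

/-- The explicit near/far radius `R₀ = 2` (sup norm) shared by the two partner stubs (documentation
constant; the registered signatures inline the literal `2`) — the same cut as `coreRadius` of line
`certified-core-eventual-tail`, so the two lines' far-field partners coincide up to rewriting. Re-cutting the
line = changing this literal in `NearField` / `FarField` / the two stubs (`1` is the fallback: then `NearField` is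
exactly the two classes `(1,1,0)`, `(1,1,1)` where the NNN-Gaussian control `G_a` fails, kit j013068). -/
def nearRadius : ℕ := 2

/-- STUB 1 `UnitRate` (new, M): under IM the nearest-neighbour direct correlation `a₁ = a(e₀)` is
POSITIVE. (That `a` takes the same value on all six unit steps is PROVED below, `dcf_single` / `dcf_neg`,
unconditionally.) -/
def UnitRate : Prop :=
  Summit.CriticalPhenomena.Ising3DConformalLimit.Theses.PrecisionLaplacian.InverseMFerromagnet →
    0 < dcf (Pi.single 0 1)

/-- STUB 2 `NearField` (partner, L): SubH at the finitely many site classes off the first shell inside the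
sup-ball of radius `2` (8 classes: `(1,1,0),(1,1,1),(2,0,0),(2,1,0),(2,1,1),(2,2,0),(2,2,1),(2,2,2)`). -/
def NearField : Prop :=
  ∀ x : Site 3, x ≠ 0 → (∀ i : Fin 3, x ≠ Pi.single i 1 ∧ x ≠ -Pi.single i 1) →
    (∀ j : Fin 3, (x j).natAbs ≤ 2) → 6 * G x ≤ nbrSum x

/-- STUB 3 `FarField` (partner, open-problem, HARDEST): SubH outside the sup-ball of radius `2`, with this
EXPLICIT radius (the ineffective `∃ R` version is route item 13887 and does not glue). -/
def FarField : Prop :=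
  ∀ x : Site 3, (∃ j : Fin 3, 2 < (x j).natAbs) → 6 * G x ≤ nbrSum x

/-- INTEROPERABILITY with line `certified-core-eventual-tail` (`coreRadius = 2`): its far-field stub
`∀ x, (2:ℝ) < ‖x‖ → 0 ≤ Δ G x` is literally equivalent to `FarField` (‖·‖ = sup norm on `ℤ³`,
`Site.norm_eq_supNorm`; `latticeLaplacianZd_nonneg_iff`), so ONE proof of the effective far field serves both
lines, and this line's `firstShell` + a certificate for the 8 classes of `NearField` replace that line's core. -/
theorem farField_iff_normForm :
    FarField ↔ ∀ x : Site 3, (2 : ℝ) < ‖x‖ → 0 ≤ latticeLaplacianZd (criticalTwoPoint 3) x := by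
  have key : ∀ x : Site 3, (2 : ℝ) < ‖x‖ ↔ ∃ j : Fin 3, 2 < (x j).natAbs := by
    intro x
    rw [Site.norm_eq_supNorm]
    constructor
    · intro h
      have h2 : 2 < Site.supNorm x := by exact_mod_cast h
      obtain ⟨i, hi⟩ := Site.exists_natAbs_eq_supNorm Finset.univ_nonempty x
      exact ⟨i, by omega⟩
    · rintro ⟨j, hj⟩
      have := Site.natAbs_le_supNorm x j
      exact_mod_cast (show 2 < Site.supNorm x by omega)
  unfold FarField
  refine forall_congr' fun x => ?_
  rw [key x, latticeLaplacianZd_nonneg_iff]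
  norm_num [nbrSum]

/-! ## Registered stubs (verbatim, fully qualified; `sorry` lives ONLY here) -/

/-- STUB `stub_unitRate` = `UnitRate` verbatim: POSITIVITY of the nearest-neighbour direct correlation
`a₁ = inf_A −(G_A⁻¹)(0,e₀)` under `InverseMFerromagnet` (item 4798); not delivered by item 4803 (triage
r1-2 (v), r1-3: the √2/√3 steps alone generate `ℤ³`). Why plausibly true: `−(G_A⁻¹)(0,e₀) = E/(1−E²) ≈ 0.37`
at `A = {0,e₀}` decreases in `A` under IM (Schur complements of M-matrices) to the OZ nearest-neighbour
direct correlation `≈ 0.15·A₀ > 0` (`a₁ = t + O(t³)` in the HT expansion); `a₁ = 0` would make the best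
linear predictor of `σ₀` ignore its neighbours although the DLR conditional law of `σ₀` depends on them
only. A proof needs a lower bound UNIFORM in `A`: e.g. partial covariance of `σ₀, σ_{e₀}` given the other
spins of `A` ≥ E[Cov(σ₀, σ_{e₀} | rest)] − (variance of the nonlinear residual of E[σ₀ | rest]), with the
conditional covariance bounded below by finite energy; size M. -/
theorem stub_unitRate : Summit.CriticalPhenomena.Ising3DConformalLimit.Theses.PrecisionLaplacian.InverseMFerromagnet →
    0 < (⨅ A : {A : Finset (Literature.Probability.LatticeModels.Site 3) // (0 : Literature.Probability.LatticeModels.Site 3) ∈ A ∧ (Pi.single 0 1 : Literature.Probability.LatticeModels.Site 3) ∈ A}, -((Matrix.of fun (p q : ↥A.1) => Literature.Probability.LatticeModels.criticalTwoPoint 3 (q.1 - p.1))⁻¹ ⟨0, A.2.1⟩ ⟨(Pi.single 0 1 : Literature.Probability.LatticeModels.Site 3), A.2.2⟩)) := by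
  sorry

/-- STUB `stub_nearField` = `NearField` verbatim: SubH at the 8 non-unit site classes with `|x|∞ ≤ 2`
(finite; semi-decidable by the lattice positivity bootstrap on a rigorous bracket of `β_c(3)` —
cards `certified-core-eventual-tail` / `sdp-bracket-certificate`; needed absolute precision ≈ 3·10⁻³ at
`(1,1,0)` by the asymptotic margin `0.0093/|x|³`, O(1/N) calibration j012193: all 83 sites positive). -/
theorem stub_nearField : ∀ x : Literature.Probability.LatticeModels.Site 3, x ≠ 0 →
    (∀ i : Fin 3, x ≠ Pi.single i 1 ∧ x ≠ -Pi.single i 1) → (∀ j : Fin 3, (x j).natAbs ≤ 2) →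
    6 * Literature.Probability.LatticeModels.criticalTwoPoint 3 x ≤ ∑ i : Fin 3, (Literature.Probability.LatticeModels.criticalTwoPoint 3 (x + Pi.single i 1) + Literature.Probability.LatticeModels.criticalTwoPoint 3 (x - Pi.single i 1)) := by
  sorry

/-- STUB `stub_farField` = `FarField` verbatim: SubH for `|x|∞ > 2`, EFFECTIVE radius. The hard core of
the crux (asymptotically `ΔG ≈ A[η(1+η)r^{−3−η} + B(1+η+ω)(η+ω)r^{−3−η−ω}]`, refuter bc059723: positive
beyond `(43|B|)^{1.2}` for either sign of `B`, but no effective handle is known; suppliers: band/shape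
positivity (card kl-band-positivity), RP-spectral cone + diagonal transfer matrix (route dossier), or an
effective tail transfer from item 4799). -/
theorem stub_farField : ∀ x : Literature.Probability.LatticeModels.Site 3, (∃ j : Fin 3, 2 < (x j).natAbs) →
    6 * Literature.Probability.LatticeModels.criticalTwoPoint 3 x ≤ ∑ i : Fin 3, (Literature.Probability.LatticeModels.criticalTwoPoint 3 (x + Pi.single i 1) + Literature.Probability.LatticeModels.criticalTwoPoint 3 (x - Pi.single i 1)) := by
  sorry

/-! ## Consistency: each named statement IS its registered stub (definitionally) -/

theorem unitRate_holds : UnitRate := stub_unitRate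
theorem nearField_holds : NearField := stub_nearField
theorem farField_holds : FarField := stub_farField

/-! ## Name-keyed aliases of the three statements (the hypotheses of the composition) -/
namespace Registered

/-- Alias of `UnitRate` keyed by the registered stub name. -/
abbrev stub_unitRate : Prop := UnitRate
/-- Alias of `NearField` keyed by the registered stub name. -/
abbrev stub_nearField : Prop := NearField
/-- Alias of `FarField` keyed by the registered stub name. -/
abbrev stub_farField : Prop := FarField

end Registered

/-! ## Proved glue I — the maximality input (Messager–Miracle-Solé / Schrader; = Disproof.lean
`le_axis_of_coords`) and the hyperoctahedral symmetry of `G` on the unit steps -/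

/-- A nonzero site has sup norm `≥ 1`. -/
theorem one_le_supNorm {z : Site 3} (hz : z ≠ 0) : 1 ≤ Site.supNorm z := by
  by_contra h
  apply hz
  funext i
  have h1 := Site.natAbs_le_supNorm z i
  have h2 : (z i).natAbs = 0 := by omega
  exact Int.natAbs_eq_zero.1 h2

/-- MAXIMALITY: `G(z) ≤ G(e₀)` for every `z ≠ 0` (sphere sandwich `G(z) ≤ G(‖z‖∞ e₀)` + axis antitonicity). -/
theorem G_le_G_e0 {z : Site 3} (hz : z ≠ 0) : G z ≤ G (Pi.single 0 1) := by
  have hn := one_le_supNorm hz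
  have h1 := (criticalTwoPoint_axis_sandwich hn).2
  have h2 : criticalTwoPoint 3 (Pi.single 0 ((Site.supNorm z : ℕ) : ℤ)) ≤
      criticalTwoPoint 3 (Pi.single 0 ((1 : ℕ) : ℤ)) := criticalTwoPoint_axis_antitone hn
  rw [Nat.cast_one] at h2
  exact h1.trans h2

/-- `G` takes the same value on the six unit steps (coordinate permutations + evenness). -/
theorem G_unit {x : Site 3} (hx : ∃ i : Fin 3, x = Pi.single i 1 ∨ x = -Pi.single i 1) :
    G x = G (Pi.single 0 1) := by
  obtain ⟨i, rfl | rfl⟩ := hx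
  · exact twoPointPlus_single_eq_single twoPointPlus_perm_invariant_holds (criticalBeta_nonneg 3) i 0 1
  · rw [show G (-Pi.single i 1) = G (Pi.single i 1) from criticalTwoPoint_neg _]
    exact twoPointPlus_single_eq_single twoPointPlus_perm_invariant_holds (criticalBeta_nonneg 3) i 0 1

/-- Maximality re-centred at any unit step: `G(z) ≤ G(x)` for `z ≠ 0`, `x ∈ {±eᵢ}`. -/
theorem G_le_G_unit {x z : Site 3} (hx : ∃ i : Fin 3, x = Pi.single i 1 ∨ x = -Pi.single i 1)
    (hz : z ≠ 0) : G z ≤ G x := by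
  rw [G_unit hx]
  exact G_le_G_e0 hz

/-! ## Proved glue II — the six unit steps as a `Finset` and its sum -/

/-- The six unit steps `{±e₀, ±e₁, ±e₂}`. -/
def unitSteps : Finset (Site 3) :=
  (Finset.univ.image fun i : Fin 3 => (Pi.single i 1 : Site 3)) ∪
    Finset.univ.image fun i : Fin 3 => (-Pi.single i 1 : Site 3)

theorem mem_unitSteps {y : Site 3} :
    y ∈ unitSteps ↔ ∃ i : Fin 3, y = Pi.single i 1 ∨ y = -Pi.single i 1 := by
  simp only [unitSteps, Finset.mem_union, Finset.mem_image, Finset.mem_univ, true_and]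
  constructor
  · rintro (⟨i, hi⟩ | ⟨i, hi⟩)
    · exact ⟨i, Or.inl hi.symm⟩
    · exact ⟨i, Or.inr hi.symm⟩
  · rintro ⟨i, hi | hi⟩
    · exact Or.inl ⟨i, hi.symm⟩
    · exact Or.inr ⟨i, hi.symm⟩

theorem single_injective : Function.Injective fun i : Fin 3 => (Pi.single i 1 : Site 3) := by
  intro i j h
  by_contra hij
  have h1 := congrFun h i
  simp only [Pi.single_eq_same, Pi.single_eq_of_ne hij] at h1
  exact one_ne_zero h1

theorem single_ne_neg_single (i j : Fin 3) : (Pi.single i 1 : Site 3) ≠ -Pi.single j 1 := by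
  intro h
  have h1 := congrFun h i
  by_cases hij : i = j
  · subst hij
    simp only [Pi.single_eq_same, Pi.neg_apply] at h1
    omega
  · simp only [Pi.single_eq_same, Pi.neg_apply, Pi.single_eq_of_ne hij, neg_zero] at h1
    exact one_ne_zero h1

/-- A sum over the six unit steps is the crux's `Σᵢ (φ(eᵢ) + φ(−eᵢ))`. -/
theorem sum_unitSteps (φ : Site 3 → ℝ) :
    ∑ y ∈ unitSteps, φ y = ∑ i : Fin 3, (φ (Pi.single i 1) + φ (-Pi.single i 1)) := by
  have hdisj : Disjoint (Finset.univ.image fun i : Fin 3 => (Pi.single i 1 : Site 3))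
      (Finset.univ.image fun i : Fin 3 => (-Pi.single i 1 : Site 3)) := by
    rw [Finset.disjoint_left]
    intro y hy hy'
    rw [Finset.mem_image] at hy hy'
    obtain ⟨i, -, rfl⟩ := hy
    obtain ⟨j, -, hj⟩ := hy'
    exact single_ne_neg_single i j hj.symm
  have hinj₁ : ∀ i ∈ (Finset.univ : Finset (Fin 3)), ∀ j ∈ (Finset.univ : Finset (Fin 3)),
      (Pi.single i 1 : Site 3) = Pi.single j 1 → i = j := fun i _ j _ h => single_injective h
  have hinj₂ : ∀ i ∈ (Finset.univ : Finset (Fin 3)), ∀ j ∈ (Finset.univ : Finset (Fin 3)),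
      (-Pi.single i 1 : Site 3) = -Pi.single j 1 → i = j :=
    fun i _ j _ h => single_injective (neg_injective h)
  rw [unitSteps, Finset.sum_union hdisj, Finset.sum_image hinj₁, Finset.sum_image hinj₂,
    ← Finset.sum_add_distrib]

/-! ## Proved glue III — the long-jump balance (identity L0 of the card, from item 4803's kernel form) -/

/-- `y ↦ a(y)·G(x−y)` is absolutely summable (`|G| ≤ 1`). -/
theorem summable_dcf_mul (x : Site 3) (hs : Summable dcf) : Summable (fun y => dcf y * G (x - y)) := by
  have h1 : Summable (fun y => |dcf y * G (x - y)|) := by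
    refine Summable.of_nonneg_of_le (fun y => abs_nonneg _) (fun y => ?_) hs.abs
    rw [abs_mul]
    refine mul_le_of_le_one_right (abs_nonneg _) (abs_le.2 ⟨?_, criticalTwoPoint_le_one' _⟩)
    linarith [criticalTwoPoint_nonneg' (x - y)]
  exact h1.of_abs

/-- THE BALANCE (card L0, identity level, no slack): for `x ≠ 0`, `Σ_y a(y)·[G(x) − G(x−y)] = 0` as an
unconditional sum — `G` is harmonic off the origin for its own conservative precision Laplacian
(criticality: total mass `0`; source term only at `x = 0`, where the convolution is `−1`). -/
theorem hasSum_balance (hK : KernelForm) {x : Site 3} (hx : x ≠ 0) :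
    HasSum (fun y => dcf y * (G x - G (x - y))) 0 := by
  obtain ⟨hs, hs0, -, -, hconv⟩ := hK
  have h1 : HasSum dcf 0 := hs.hasSum_iff.2 hs0
  have h2 : HasSum (fun y => dcf y * G (x - y)) 0 :=
    (summable_dcf_mul x hs).hasSum_iff.2 ((hconv x).trans (if_neg hx))
  have h3 := (h1.mul_right (G x)).sub h2
  rw [zero_mul, sub_zero] at h3
  exact h3.congr_fun fun y => by ring

/-! ## Proved glue IV — hyperoctahedral symmetry of the canonical direct-correlation function
(`a(±eᵢ) = a(e₀)`, unconditionally: no IM needed) -/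

/-- Transport of a finite index set `A ⊂ ℤ³` under a lattice symmetry `φ`. -/
def imageEquiv (φ : Site 3 ≃ Site 3) (A : Finset (Site 3)) : ↥A ≃ ↥(A.image φ) where
  toFun p := ⟨φ p.1, Finset.mem_image_of_mem φ p.2⟩
  invFun q := ⟨φ.symm q.1, by
    obtain ⟨p, hp, hpq⟩ := Finset.mem_image.1 q.2
    rw [← hpq, Equiv.symm_apply_apply]
    exact hp⟩
  left_inv p := Subtype.ext (φ.symm_apply_apply p.1)
  right_inv q := Subtype.ext (φ.apply_symm_apply q.1)

/-- The index families `{A ∋ 0, y}` and `{B ∋ 0, φ y}` of the infimum correspond under `A ↦ φ(A)`. -/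
def idxEquiv (φ : Site 3 ≃ Site 3) (h0 : φ 0 = 0) (y : Site 3) :
    {A : Finset (Site 3) // (0 : Site 3) ∈ A ∧ y ∈ A} ≃
      {B : Finset (Site 3) // (0 : Site 3) ∈ B ∧ φ y ∈ B} where
  toFun A := ⟨A.1.image φ, Finset.mem_image.2 ⟨0, A.2.1, h0⟩, Finset.mem_image_of_mem φ A.2.2⟩
  invFun B := ⟨B.1.image φ.symm, Finset.mem_image.2 ⟨0, B.2.1, φ.symm_apply_eq.2 h0.symm⟩,
    Finset.mem_image.2 ⟨φ y, B.2.2, φ.symm_apply_apply y⟩⟩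
  left_inv A := Subtype.ext (by simp [Finset.image_image])
  right_inv B := Subtype.ext (by simp [Finset.image_image])

/-- Transport of the inverse two-point matrix: `(G_{φA})⁻¹(φa, φb) = (G_A)⁻¹(a, b)` for an additive
bijection `φ` leaving `G` invariant (`G_{φA} = reindex G_A`, `Matrix.inv_reindex`). -/
theorem inv_entry_image (φ : Site 3 ≃ Site 3)
    (hadds : ∀ p q : Site 3, φ.symm (q - p) = φ.symm q - φ.symm p)
    (hGs : ∀ z : Site 3, G (φ.symm z) = G z) (A : Finset (Site 3)) (a b : ↥A) :
    (Matrix.of fun (p q : ↥(A.image φ)) => G (q.1 - p.1))⁻¹ (imageEquiv φ A a) (imageEquiv φ A b) =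
      (Matrix.of fun (p q : ↥A) => G (q.1 - p.1))⁻¹ a b := by
  have hM : (Matrix.of fun (p q : ↥(A.image φ)) => G (q.1 - p.1)) =
      Matrix.reindex (imageEquiv φ A) (imageEquiv φ A) (Matrix.of fun (p q : ↥A) => G (q.1 - p.1)) := by
    ext q q'
    simp only [Matrix.reindex_apply, Matrix.submatrix_apply, Matrix.of_apply]
    show G (q'.1 - q.1) = G (φ.symm q'.1 - φ.symm q.1)
    rw [← hadds, hGs]
  rw [hM, Matrix.inv_reindex, Matrix.reindex_apply, Matrix.submatrix_apply, Equiv.symm_apply_apply,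
    Equiv.symm_apply_apply]

/-- **Equivariance of the canonical direct-correlation function**: `a(φ y) = a(y)` for every additive
bijection `φ` of `ℤ³` leaving `G` invariant (transport of structure: `G_{φA} = reindex G_A`, so
`(G_{φA})⁻¹(0, φy) = (G_A)⁻¹(0, y)` by `Matrix.inv_reindex`, and `A ↦ φ(A)` is a bijection of the index
families). No inverse-M hypothesis is needed. -/
theorem dcf_equivariant (φ : Site 3 ≃ Site 3) (hadd : ∀ p q : Site 3, φ (q - p) = φ q - φ p)
    (hG : ∀ z : Site 3, G (φ z) = G z) (y : Site 3) : dcf (φ y) = dcf y := by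
  have h0 : φ 0 = 0 := by simpa using hadd 0 0
  have hGs : ∀ z : Site 3, G (φ.symm z) = G z := fun z => by
    conv_rhs => rw [← φ.apply_symm_apply z]
    exact (hG _).symm
  have hadds : ∀ p q : Site 3, φ.symm (q - p) = φ.symm q - φ.symm p := fun p q =>
    φ.injective (by rw [hadd, φ.apply_symm_apply, φ.apply_symm_apply, φ.apply_symm_apply])
  symm
  unfold dcf
  refine Equiv.iInf_congr (idxEquiv φ h0 y) fun A => ?_
  dsimp only [idxEquiv, Equiv.coe_fn_mk]
  have e1 : (⟨0, Finset.mem_image.2 ⟨0, A.2.1, h0⟩⟩ : ↥(A.1.image φ)) = imageEquiv φ A.1 ⟨0, A.2.1⟩ :=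
    Subtype.ext h0.symm
  have e2 : (⟨φ y, Finset.mem_image_of_mem φ A.2.2⟩ : ↥(A.1.image φ)) = imageEquiv φ A.1 ⟨y, A.2.2⟩ :=
    Subtype.ext rfl
  rw [e1, e2, inv_entry_image φ hadds hGs]

/-- The coordinate transposition `x ↦ x ∘ (i 0)` as a lattice symmetry. -/
def swapCoord (i : Fin 3) : Site 3 ≃ Site 3 where
  toFun x := fun j => x (Equiv.swap i 0 j)
  invFun x := fun j => x (Equiv.swap i 0 j)
  left_inv x := by funext j; simp [Equiv.swap_apply_self]
  right_inv x := by funext j; simp [Equiv.swap_apply_self]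

theorem swapCoord_single (i : Fin 3) : swapCoord i (Pi.single 0 1) = Pi.single i 1 := by
  funext j
  show (Pi.single (0 : Fin 3) (1 : ℤ) : Site 3) (Equiv.swap i 0 j) = (Pi.single i (1 : ℤ) : Site 3) j
  by_cases hj : j = i
  · subst hj
    simp
  · rw [Pi.single_eq_of_ne hj]
    by_cases hj0 : j = 0
    · subst hj0
      rw [Equiv.swap_apply_right]
      exact Pi.single_eq_of_ne (Ne.symm hj) _
    · rw [Equiv.swap_apply_of_ne_of_ne hj hj0]
      exact Pi.single_eq_of_ne hj0 _

/-- `a(eᵢ) = a(e₀)` (coordinate permutation invariance of `G`, `twoPointPlus_perm_invariant_holds`). -/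
theorem dcf_single (i : Fin 3) : dcf (Pi.single i 1) = dcf (Pi.single 0 1) := by
  rw [← swapCoord_single i]
  exact dcf_equivariant (swapCoord i) (fun p q => rfl)
    (fun z => twoPointPlus_perm_invariant_holds (criticalBeta_nonneg 3) (Equiv.swap i 0) z) _

/-- `a(−y) = a(y)` (evenness of `G`, `criticalTwoPoint_neg`). -/
theorem dcf_neg (y : Site 3) : dcf (-y) = dcf y :=
  dcf_equivariant (Equiv.neg (Site 3)) (fun p q => by simp only [Equiv.neg_apply]; abel)
    (fun z => by simp only [Equiv.neg_apply]; exact criticalTwoPoint_neg z) y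

/-- The kernel is the constant `a₁ = a(e₀)` on the six unit steps (PROVED; formerly half of `UnitRate`). -/
theorem dcf_unit_symm (i : Fin 3) :
    dcf (Pi.single i 1) = dcf (Pi.single 0 1) ∧ dcf (-Pi.single i 1) = dcf (Pi.single 0 1) :=
  ⟨dcf_single i, (dcf_neg _).trans (dcf_single i)⟩

/-- On the six unit steps the kernel is the constant `a₁ = a(e₀)` (`UnitRate`'s symmetry conjunct), so
the unit-step part of the balance is `a₁ · (6·G(x) − N(x))`. -/
theorem sum_unitSteps_balance
    (hsym : ∀ i : Fin 3, dcf (Pi.single i 1) = dcf (Pi.single 0 1) ∧ dcf (-Pi.single i 1) = dcf (Pi.single 0 1))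
    (x : Site 3) :
    ∑ y ∈ unitSteps, dcf y * (G x - G (x - y)) = dcf (Pi.single 0 1) * (6 * G x - nbrSum x) := by
  rw [sum_unitSteps (fun y => dcf y * (G x - G (x - y)))]
  have hev : ∀ i : Fin 3,
      dcf (Pi.single i 1) * (G x - G (x - Pi.single i 1)) +
        dcf (-Pi.single i 1) * (G x - G (x - -Pi.single i 1)) =
      dcf (Pi.single 0 1) * (2 * G x - (G (x + Pi.single i 1) + G (x - Pi.single i 1))) := by
    intro i
    rw [(hsym i).1, (hsym i).2, sub_neg_eq_add]
    ring
  rw [Finset.sum_congr rfl fun i _ => hev i, ← Finset.mul_sum]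
  congr 1
  simp only [nbrSum, Fin.sum_univ_three]
  ring

/-- **Card identity L0 (proved): the lattice Laplacian IS the long-range part of the precision kernel
acting on `G`.** For `x ≠ 0`, `a₁ · (N(x) − 6·G(x)) = Σ_{y ∉ {±eᵢ}} a(y)·[G(x) − G(x−y)]` as an
unconditional sum (the `y = 0` term vanishes; no sign is claimed here — beyond the first shell the terms
have both signs, triage r1-1 (iv)). This is the exact reduction of SubH at any site to precision entries
and short-distance values of `G` that the card's items (3)(c) and the cheapest falsifier refer to. -/
theorem longJump_identity (hK : KernelForm)
    (hsym : ∀ i : Fin 3, dcf (Pi.single i 1) = dcf (Pi.single 0 1) ∧ dcf (-Pi.single i 1) = dcf (Pi.single 0 1))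
    {x : Site 3} (hx : x ≠ 0) :
    HasSum (fun y => if y ∈ unitSteps then 0 else dcf y * (G x - G (x - y)))
      (dcf (Pi.single 0 1) * (nbrSum x - 6 * G x)) := by
  have hbal := hasSum_balance hK hx
  have hfin : HasSum (fun y => if y ∈ unitSteps then dcf y * (G x - G (x - y)) else 0)
      (∑ y ∈ unitSteps, if y ∈ unitSteps then dcf y * (G x - G (x - y)) else 0) :=
    hasSum_sum_of_ne_finset_zero fun y hy => if_neg hy
  rw [Finset.sum_congr rfl fun y hy => if_pos hy, sum_unitSteps_balance hsym x] at hfin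
  have hrest := hbal.sub hfin
  rw [show (0 : ℝ) - dcf (Pi.single 0 1) * (6 * G x - nbrSum x) =
      dcf (Pi.single 0 1) * (nbrSum x - 6 * G x) by ring] at hrest
  refine hrest.congr_fun fun y => ?_
  by_cases hy : y ∈ unitSteps <;> simp [hy]

/-! ## THE FIRST SHELL (card L1): kernel form + `UnitRate` ⇒ SubH at the six unit steps, term by term -/

/-- **First shell.** Under the kernel form of item 4803 and `UnitRate`'s two conclusions, SubH holds at
every unit step `x = ±eᵢ`: in the balance `Σ_y a(y)[G(x) − G(x−y)] = 0` every term with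
`y ∉ {±eⱼ}` is `≥ 0` (`a(y) ≥ 0`, `G(x−y) ≤ G(x)` by maximality since `x − y ≠ 0`; the `y = 0` term
vanishes), so the six unit-step terms sum to `≤ 0`, i.e. `a₁·(6G(x) − N(x)) ≤ 0` with `a₁ > 0`. -/
theorem firstShell (hK : KernelForm)
    (hsym : ∀ i : Fin 3, dcf (Pi.single i 1) = dcf (Pi.single 0 1) ∧ dcf (-Pi.single i 1) = dcf (Pi.single 0 1))
    (ha : 0 < dcf (Pi.single 0 1)) {x : Site 3} (hxU : ∃ i : Fin 3, x = Pi.single i 1 ∨ x = -Pi.single i 1) :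
    6 * G x ≤ nbrSum x := by
  have hx0 : x ≠ 0 := by
    obtain ⟨i, rfl | rfl⟩ := hxU
    · intro h
      have h1 := congrFun h i
      simp at h1
    · intro h
      have h1 := congrFun h i
      simp at h1
  have hbal := hasSum_balance hK hx0
  -- nonnegativity of the balance terms off the six unit steps
  have hnn : ∀ y ∉ unitSteps, 0 ≤ dcf y * (G x - G (x - y)) := by
    intro y hy
    by_cases hy0 : y = 0
    · subst hy0
      simp
    · have hyx : x - y ≠ 0 := by
        intro h
        rw [sub_eq_zero] at h
        subst h
        exact hy (mem_unitSteps.2 hxU)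
      exact mul_nonneg (hK.2.2.1 y hy0) (sub_nonneg.2 (G_le_G_unit hxU hyx))
  -- the six unit-step terms therefore sum to ≤ 0, and they sum to `a₁ · (6 G x − N x)` with `a₁ > 0`
  have hle := sum_le_hasSum unitSteps hnn hbal
  rw [sum_unitSteps_balance hsym x] at hle
  nlinarith

/-! ## The composition: the stubs (+ items 4798, 4803 by name) imply the crux, BY NAME -/

/-- `SubharmonicOffOrigin` from: `InverseMFerromagnet` (item 4798, route PrecisionLaplacian),
`PrecisionIsLaplacian` (item 4803), and the three registered stubs — pure case analysis:
`x ∈ {±eᵢ}` → `firstShell` (item 4802 being discharged by the landed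
`Theorems.InverseMCriticalKernel_proof`); `|x|∞ ≤ 2` off the first shell → `NearField`;
`|x|∞ > 2` → `FarField`. -/
theorem SubharmonicOffOrigin_of
    (hIM : Summit.CriticalPhenomena.Ising3DConformalLimit.Theses.PrecisionLaplacian.InverseMFerromagnet)
    (hPIL : Summit.CriticalPhenomena.Ising3DConformalLimit.Theses.PrecisionLaplacian.PrecisionIsLaplacian)
    (hU : Registered.stub_unitRate) (hN : Registered.stub_nearField) (hF : Registered.stub_farField) :
    Summit.CriticalPhenomena.Ising3DConformalLimit.Theses.PerfectScreening.SubharmonicOffOrigin := by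
  have hK : KernelForm :=
    (precisionIsLaplacian_iff.1 hPIL)
      ((inverseMCriticalKernel_iff.1
        Summit.CriticalPhenomena.Ising3DConformalLimit.Theorems.InverseMCriticalKernel_proof) hIM)
  have ha : 0 < dcf (Pi.single 0 1) := hU hIM
  intro x hx
  by_cases hunit : ∃ i : Fin 3, x = Pi.single i 1 ∨ x = -Pi.single i 1
  · exact firstShell hK dcf_unit_symm ha hunit
  · push Not at hunit
    by_cases hnear : ∀ j : Fin 3, (x j).natAbs ≤ 2
    · exact hN x hx hunit hnear
    · push Not at hnear
      exact hF x hnear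

/-- Wiring check: the registered stubs feed `SubharmonicOffOrigin_of` as stated (items 4798/4803 stay
hypotheses: they are other routes' open items). -/
example
    (hIM : Summit.CriticalPhenomena.Ising3DConformalLimit.Theses.PrecisionLaplacian.InverseMFerromagnet)
    (hPIL : Summit.CriticalPhenomena.Ising3DConformalLimit.Theses.PrecisionLaplacian.PrecisionIsLaplacian) :
    Summit.CriticalPhenomena.Ising3DConformalLimit.Theses.PerfectScreening.SubharmonicOffOrigin :=
  SubharmonicOffOrigin_of hIM hPIL stub_unitRate stub_nearField stub_farField

/-! ## Dividends (kernel-checked) -/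

/-- THE REACH OF THE LEVER ALONE: IM (4798) + kernel form (4803) + `UnitRate` give SubH at the six
nearest neighbours — the numerically thinnest sites of the crux — with no partner. -/
theorem subH_unitSteps_of_IM
    (hIM : Summit.CriticalPhenomena.Ising3DConformalLimit.Theses.PrecisionLaplacian.InverseMFerromagnet)
    (hPIL : Summit.CriticalPhenomena.Ising3DConformalLimit.Theses.PrecisionLaplacian.PrecisionIsLaplacian)
    (hU : UnitRate) :
    ∀ x : Site 3, (∃ i : Fin 3, x = Pi.single i 1 ∨ x = -Pi.single i 1) → 6 * G x ≤ nbrSum x := by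
  have hK : KernelForm :=
    (precisionIsLaplacian_iff.1 hPIL)
      ((inverseMCriticalKernel_iff.1
        Summit.CriticalPhenomena.Ising3DConformalLimit.Theorems.InverseMCriticalKernel_proof) hIM)
  intro x hxU
  exact firstShell hK dcf_unit_symm (hU hIM) hxU

/-- CROSS-ROUTE KILL (contrapositive): a violation of SubH at a unit step — e.g. a Monte-Carlo
`G(2,0,0) + 4·G(1,1,0) + 1 < 6·G(1,0,0)` at `β_c(3)` — refutes `InverseMFerromagnet` for the critical
`ℤ³` Ising kernel, given item 4803 and `UnitRate`. -/
theorem not_inverseM_of_unitStep_violation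
    (hPIL : Summit.CriticalPhenomena.Ising3DConformalLimit.Theses.PrecisionLaplacian.PrecisionIsLaplacian)
    (hU : UnitRate) {x : Site 3} (hxU : ∃ i : Fin 3, x = Pi.single i 1 ∨ x = -Pi.single i 1)
    (hlt : nbrSum x < 6 * G x) :
    ¬ Summit.CriticalPhenomena.Ising3DConformalLimit.Theses.PrecisionLaplacian.InverseMFerromagnet :=
  fun hIM => absurd (subH_unitSteps_of_IM hIM hPIL hU x hxU) (not_le.2 hlt)

end Summit.CriticalPhenomena.Ising3DConformalLimit.Cruxes.SubharmonicOffOrigin.DirectCorrelationShells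

end
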